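import Mathlib
import HarnessLib
import Literature.NumberTheory.LFunctions.RiemannXi
import Literature.NumberTheory.LFunctions.RiemannXiLogDeriv
import Literature.NumberTheory.LFunctions.RiemannXiHadamardProduct
import Literature.Analysis.SpecialFunctions.DigammaGauss
import Summits.RiemannHypothesis.RiemannHypothesis.Theorems.DeBrangesSuzukiDoorDefs
import Literature.NumberTheory.LFunctions.DeBruijnHLogDerivSeries

/-!
# RiemannHypothesis / DeBrangesSuzukiDoor — crux `KernelSupport` (K3), stub `stub_symbolDecayUniform`

Registered stub of the BC3 birth skeleton of `DeBrangesSuzukiDoor.KernelSupport` (stmt-RiemannHypothesis-19727;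
planner rh-dbr-theory g4, `KernelSupport_line_birth.lean` sha16 6b04a5da75418a33; the SHARED load-bearing child of K3
and K4), proved BY NAME with the registered signature (namespace `…Cruxes.KernelSupport.Birth`, `thetaSym` from the
Defs file): for `θ > 10` there is `C` (here `C = exp(46 θ)`) such that for every line `Im z = b ≥ 1` and every `u`,
`‖Θ_θ(u + ib)‖ ≤ C (1 + |u|)^{-θ/10}`.

Proof (RH-FREE, uniform in `b`): with `s = ½ − i(u+ib) = (½+b) − iu`, `Re s ≥ 3/2`,
`‖Θ_θ(u+ib)‖ = exp(−2θ Re ξ'/ξ(s))`.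
* `|u| ≤ 5`: `Re ξ'/ξ(s) ≥ 0` on `Re s ≥ 1` (Hadamard sum, `re_logDeriv_riemannXi_nonneg`), so `‖Θ‖ ≤ 1`.
* `|u| ≥ 5`: the explicit formula `ξ'/ξ(s) = 1/s + 1/(s−1) − (log π)/2 + ½ψ(s/2) − L_Λ(s)`
  (`logDeriv_riemannXi_eq_of_one_lt_re`) with `Re 1/s, Re 1/(s−1) ≥ 0`, the Stirling LOWER bound
  `Re ψ(w) ≥ log‖w‖ − 1/(2‖w‖²) − π/(4|Im w|)` (`Literature.Analysis.SpecialFunctions.Complex.log_norm_sub_le_re_digamma`,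
  `w = s/2`, `|Im w| = |u|/2 ≥ 5/2`) and the crude uniform bound `‖L_Λ(s)‖ ≤ 20` on `Re s ≥ 3/2`
  (`Λ(n) ≤ log n ≤ 4 n^{1/4}`, `∑ n^{-5/4} ≤ 5` by the integral test) give `Re ξ'/ξ(s) ≥ ½ log|u| − 23`, hence
  `‖Θ‖ ≤ e^{46θ}|u|^{−θ} ≤ e^{46θ}(1+|u|)^{-θ/10}`.
Nothing here bears on the truth of RH.
-/

noncomputable section

-- D-0017: `Summit.<S>.<S>.…` is the designed namespace of a single-problem summit.
set_option linter.dupNamespace false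

open MeasureTheory Complex Filter Topology Set LSeries
open scoped Real LSeries.notation ArithmeticFunction.vonMangoldt

namespace Summit.RiemannHypothesis.RiemannHypothesis.Cruxes.KernelSupport.Birth

open Literature.NumberTheory.LFunctions

/-! ### `∑ n^{-5/4} ≤ 5` and a uniform bound for `‖L_Λ(s)‖` on `Re s ≥ 3/2` -/

/-- `∑_{n ≥ 1} n^{−5/4} ≤ 5` (integral test: `∑_{n ≥ 2} n^{−5/4} ≤ ∫_1^∞ x^{−5/4} dx = 4`). -/
theorem tsum_one_div_rpow_five_fourths_le_five :
    ∑' n : ℕ, 1 / (n : ℝ) ^ (5 / 4 : ℝ) ≤ 5 := by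
  set f : ℝ → ℝ := fun x ↦ 1 / x ^ (5 / 4 : ℝ) with hf
  have hsum : Summable fun n : ℕ ↦ f n :=
    Real.summable_one_div_nat_rpow.mpr (by norm_num)
  have hanti : AntitoneOn f (Set.Ici ((1 : ℕ) : ℝ)) := by
    intro x hx y _ hxy
    simp only [Set.mem_Ici, Nat.cast_one] at hx
    have hx0 : 0 < x := by linarith
    simp only [hf]
    exact one_div_le_one_div_of_le (Real.rpow_pos_of_pos hx0 _)
      (Real.rpow_le_rpow hx0.le hxy (by norm_num))
  have hcongr : Set.EqOn f (fun x ↦ x ^ (-(5 / 4) : ℝ)) (Set.Ioi ((1 : ℕ) : ℝ)) := by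
    intro x hx
    simp only [Set.mem_Ioi, Nat.cast_one] at hx
    simp only [hf]
    rw [Real.rpow_neg (by linarith), one_div]
  have hint : IntegrableOn f (Set.Ioi ((1 : ℕ) : ℝ)) := by
    refine IntegrableOn.congr_fun ?_ hcongr.symm measurableSet_Ioi
    have := integrableOn_Ioi_rpow_of_lt (by norm_num : (-(5 / 4) : ℝ) < -1) (by norm_num : (0 : ℝ) < 1)
    simpa using this
  have hnonneg : ∀ t ∈ Set.Ioi ((1 : ℕ) : ℝ), 0 ≤ f t := by
    intro t ht
    simp only [Set.mem_Ioi, Nat.cast_one] at ht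
    simp only [hf]
    positivity
  have htail : ∑' n : ℕ, f (n + 1 + 1 : ℕ) ≤ ∫ x in Set.Ioi ((1 : ℕ) : ℝ), f x :=
    hanti.tsum_comp_add_le_integral 1 hint hnonneg
  have hval : ∫ x in Set.Ioi ((1 : ℕ) : ℝ), f x = 4 := by
    rw [setIntegral_congr_fun measurableSet_Ioi hcongr]
    simp only [Nat.cast_one]
    rw [integral_Ioi_rpow_of_lt (by norm_num) (by norm_num)]
    norm_num
  have h0 : f (0 : ℕ) = 0 := by simp [hf, Real.zero_rpow (by norm_num : (5 / 4 : ℝ) ≠ 0)]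
  have h1 : f (1 : ℕ) = 1 := by simp [hf]
  have hsplit : ∑' n : ℕ, f n = f (0 : ℕ) + (f (1 : ℕ) + ∑' n : ℕ, f (n + 1 + 1 : ℕ)) := by
    rw [hsum.tsum_eq_zero_add]
    congr 1
    have hsum1 : Summable fun n : ℕ ↦ f (n + 1 : ℕ) := (summable_nat_add_iff 1).mpr hsum
    rw [hsum1.tsum_eq_zero_add]
  show ∑' n : ℕ, f n ≤ 5
  rw [hsplit, h0, h1]
  linarith [htail, hval]

/-- RH-FREE crude uniform bound: `‖L_Λ(s)‖ ≤ 20` for `Re s ≥ 3/2`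
(`Λ(n) ≤ log n ≤ 4 n^{1/4}`, `n^{Re s} ≥ n^{3/2}`, `∑ n^{−5/4} ≤ 5`). -/
theorem norm_LSeries_vonMangoldt_le_of_threeHalves_le_re {s : ℂ} (hs : 3 / 2 ≤ s.re) :
    ‖L ↗Λ s‖ ≤ 20 := by
  have hs1 : 1 < s.re := by linarith
  have hsum : Summable fun n ↦ ‖term ↗Λ s n‖ :=
    (ArithmeticFunction.LSeriesSummable_vonMangoldt hs1).norm
  set h : ℕ → ℝ := fun n ↦ 4 * (1 / (n : ℝ) ^ (5 / 4 : ℝ)) with hh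
  have hh_summ : Summable h :=
    (Real.summable_one_div_nat_rpow.mpr (by norm_num : (1 : ℝ) < 5 / 4)).mul_left 4
  have hle : ∀ n, ‖term ↗Λ s n‖ ≤ h n := by
    intro n
    rw [norm_term_eq]
    rcases eq_or_ne n 0 with rfl | hn0
    · simp [hh]
    rw [if_neg hn0]
    simp only [hh]
    have hn1 : (1 : ℝ) ≤ n := by exact_mod_cast Nat.one_le_iff_ne_zero.mpr hn0
    have hn0' : (0 : ℝ) < n := by linarith
    have hΛ : ‖((Λ n : ℝ) : ℂ)‖ ≤ 4 * (n : ℝ) ^ (1 / 4 : ℝ) := by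
      rw [Complex.norm_real, Real.norm_eq_abs, abs_of_nonneg ArithmeticFunction.vonMangoldt_nonneg]
      have h1 : Λ n ≤ Real.log n := ArithmeticFunction.vonMangoldt_le_log
      have h2 : Real.log (n : ℝ) ≤ (n : ℝ) ^ (1 / 4 : ℝ) / (1 / 4) :=
        Real.log_le_rpow_div hn0'.le (by norm_num)
      have h3 : (n : ℝ) ^ (1 / 4 : ℝ) / (1 / 4) = 4 * (n : ℝ) ^ (1 / 4 : ℝ) := by ring
      linarith
    have hpow : (n : ℝ) ^ (3 / 2 : ℝ) ≤ (n : ℝ) ^ s.re :=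
      Real.rpow_le_rpow_of_exponent_le hn1 hs
    have hp32 : 0 < (n : ℝ) ^ (3 / 2 : ℝ) := Real.rpow_pos_of_pos hn0' _
    have hsplit : (n : ℝ) ^ (3 / 2 : ℝ) = (n : ℝ) ^ (1 / 4 : ℝ) * (n : ℝ) ^ (5 / 4 : ℝ) := by
      rw [← Real.rpow_add hn0']; norm_num
    have hp14 : 0 < (n : ℝ) ^ (1 / 4 : ℝ) := Real.rpow_pos_of_pos hn0' _
    have hp54 : 0 < (n : ℝ) ^ (5 / 4 : ℝ) := Real.rpow_pos_of_pos hn0' _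
    calc ‖((Λ n : ℝ) : ℂ)‖ / (n : ℝ) ^ s.re ≤ (4 * (n : ℝ) ^ (1 / 4 : ℝ)) / (n : ℝ) ^ (3 / 2 : ℝ) := by
          gcongr
      _ = 4 * (1 / (n : ℝ) ^ (5 / 4 : ℝ)) := by
          rw [hsplit]; field_simp
  calc ‖L ↗Λ s‖ = ‖∑' n, term ↗Λ s n‖ := rfl
    _ ≤ ∑' n, ‖term ↗Λ s n‖ := norm_tsum_le_tsum_norm hsum
    _ ≤ ∑' n, h n := hsum.tsum_le_tsum hle hh_summ
    _ = 4 * ∑' n : ℕ, 1 / (n : ℝ) ^ (5 / 4 : ℝ) := by rw [hh, tsum_mul_left]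
    _ ≤ 4 * 5 := by gcongr; exact tsum_one_div_rpow_five_fourths_le_five
    _ = 20 := by norm_num

/-! ### The symbol on the line `Im z = b` -/

/-- RH-FREE. `Re ξ'/ξ(s) ≥ 0` for `Re s ≥ 1` (Hadamard sum `∑_ρ Re 1/(s−ρ)`, termwise `≥ 0` since
`0 < Re ρ < 1`; tree `IsHadamardSeq.re_logDeriv_riemannXi_eq_tsum`). (K3-namespace copy of the
scratch lemma; also in `SuzukiDoor.re_logDeriv_riemannXi_nonneg`.) -/
theorem re_logDeriv_riemannXi_nonneg {s : ℂ} (hs : 1 ≤ s.re) : 0 ≤ (logDeriv riemannXi s).re := by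
  obtain ⟨b, hb⟩ := exists_isHadamardSeq 0
  have hξ : riemannXi s ≠ 0 := riemannXi_ne_zero_of_one_le_re hs
  rw [hb.re_logDeriv_riemannXi_eq_tsum hξ]
  refine tsum_nonneg fun n => ?_
  split_ifs with hn
  · exact le_rfl
  · obtain ⟨-, h0, h1⟩ := hb.riemannZeta_xiZero hn
    have h2 : (1 - IsHadamardSeq.xiZero b n).re < s.re := by
      rw [sub_re, one_re]; linarith
    exact (add_pos (IsHadamardSeq.re_inv_sub_pos (by linarith)) (IsHadamardSeq.re_inv_sub_pos h2)).le

/-- RH-FREE: `‖Θ_θ(z)‖ = exp(−2θ · Re ξ'/ξ(½ − iz))`. -/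
theorem norm_thetaSym (θ : ℝ) (z : ℂ) :
    ‖thetaSym θ z‖ = Real.exp (-2 * θ * (logDeriv riemannXi (1 / 2 - I * z)).re) := by
  unfold thetaSym
  rw [Complex.norm_exp, logDeriv_apply]
  congr 1
  have h : (-2 * (θ : ℂ) * (deriv riemannXi (1 / 2 - I * z) / riemannXi (1 / 2 - I * z))) =
      (((-2 * θ : ℝ)) : ℂ) * (deriv riemannXi (1 / 2 - I * z) / riemannXi (1 / 2 - I * z)) := by
    push_cast; ring
  rw [h, Complex.re_ofReal_mul]

/-- `½ − i(u + ib) = (½ + b) − iu`. -/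
theorem half_sub_I_mul_line_b (u b : ℝ) :
    (1 : ℂ) / 2 - I * ((u : ℂ) + (b : ℂ) * I) = ((1 / 2 + b : ℝ) : ℂ) + ((-u : ℝ) : ℂ) * I := by
  push_cast
  linear_combination (-(b : ℂ)) * I_mul_I

/-- RH-FREE: `‖Θ_θ(u + ib)‖ = exp(−2θ · Re ξ'/ξ((½+b) − iu))`. -/
theorem norm_thetaSym_line (θ u b : ℝ) :
    ‖thetaSym θ ((u : ℂ) + (b : ℂ) * I)‖ =
      Real.exp (-2 * θ * (logDeriv riemannXi (((1 / 2 + b : ℝ) : ℂ) + ((-u : ℝ) : ℂ) * I)).re) := by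
  rw [norm_thetaSym, half_sub_I_mul_line_b]

/-- RH-FREE lower bound for the real part of `ξ'/ξ` on `Re s ≥ 3/2`, `|Im s| ≥ 5`:
`Re ξ'/ξ(σ − iu) ≥ ½ log|u| − 23`. -/
theorem re_logDeriv_riemannXi_ge_of_five_le {σ u : ℝ} (hσ : 3 / 2 ≤ σ) (hu : 5 ≤ |u|) :
    Real.log |u| / 2 - 23 ≤ (logDeriv riemannXi (((σ : ℝ) : ℂ) + ((-u : ℝ) : ℂ) * I)).re := by
  set s : ℂ := ((σ : ℝ) : ℂ) + ((-u : ℝ) : ℂ) * I with hs_def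
  have hsre : s.re = σ := by simp [hs_def]
  have hsim : s.im = -u := by simp [hs_def]
  have hs1 : 1 < s.re := by rw [hsre]; linarith
  rw [logDeriv_riemannXi_eq_of_one_lt_re hs1]
  -- real parts of the pieces
  have h1 : 0 ≤ (1 / s).re := by
    have := IsHadamardSeq.re_inv_sub_pos (s := s) (ρ := 0) (by simp [hsre]; linarith)
    simpa using this.le
  have h2 : 0 ≤ (1 / (s - 1)).re :=
    (IsHadamardSeq.re_inv_sub_pos (s := s) (ρ := 1) (by simp [hsre]; linarith)).le
  have hL : -20 ≤ -(L ↗Λ s).re := by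
    have hn := norm_LSeries_vonMangoldt_le_of_threeHalves_le_re (s := s) (by rw [hsre]; exact hσ)
    have := Complex.abs_re_le_norm (L ↗Λ s)
    have := (abs_le.1 (this.trans hn)).2
    linarith
  -- digamma lower bound at w = s/2
  set w : ℂ := s / 2 with hw
  have hwre : 0 < w.re := by simp [hw, hsre]; linarith
  have hwim : w.im = -u / 2 := by simp [hw, hsim]
  have hu0 : 0 < |u| := by linarith
  have hwim_ne : w.im ≠ 0 := by
    rw [hwim]; intro h; have : u = 0 := by linarith
    rw [this, abs_zero] at hu; linarith
  have habsim : |w.im| = |u| / 2 := by rw [hwim, abs_div, abs_neg, abs_two]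
  have hψ := Literature.Analysis.SpecialFunctions.Complex.log_norm_sub_le_re_digamma hwre hwim_ne
  have hnorm_ge : |u| / 2 ≤ ‖w‖ := by rw [← habsim]; exact Complex.abs_im_le_norm w
  have hnorm_pos : 0 < ‖w‖ := by linarith
  have hlog_w : Real.log (|u| / 2) ≤ Real.log ‖w‖ := Real.log_le_log (by positivity) hnorm_ge
  have hlog_split : Real.log (|u| / 2) = Real.log |u| - Real.log 2 := Real.log_div hu0.ne' two_ne_zero
  have hlog2 : Real.log 2 ≤ 1 := by
    have := Real.log_le_sub_one_of_pos (show (0 : ℝ) < 2 by norm_num); linarith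
  have hA : 1 / (2 * ‖w‖ ^ 2) ≤ 2 / 25 := by
    have h52 : 5 / 2 ≤ ‖w‖ := by linarith
    have hw2 : 25 / 4 ≤ ‖w‖ ^ 2 := by nlinarith
    rw [div_le_div_iff₀ (by positivity) (by norm_num)]
    nlinarith
  have hB : π / (4 * |w.im|) ≤ π / 10 := by
    rw [habsim]
    apply div_le_div_of_nonneg_left Real.pi_pos.le (by norm_num)
    linarith
  have hπ4 : π / 10 ≤ 2 / 5 := by linarith [Real.pi_lt_four]
  have hlogπ : Real.log π ≤ 3 := by
    have := Real.log_le_sub_one_of_pos Real.pi_pos; linarith [Real.pi_lt_four]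
  -- Re of the archimedean term
  have harch : (-(Real.log π : ℂ) / 2 + 1 / 2 * digamma w).re = -(Real.log π) / 2 + (digamma w).re / 2 := by
    simp [Complex.add_re, Complex.mul_re, Complex.neg_re]
    ring
  -- assemble
  have hre : (1 / s + 1 / (s - 1) + (-(Real.log π : ℂ) / 2 + 1 / 2 * digamma (s / 2)) - L ↗Λ s).re =
      (1 / s).re + (1 / (s - 1)).re + (-(Real.log π) / 2 + (digamma w).re / 2) - (L ↗Λ s).re := by
    rw [Complex.sub_re, Complex.add_re, Complex.add_re, ← hw, harch]
  rw [hre]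
  linarith

/-- **Registered stub `stub_symbolDecayUniform` of crux `KernelSupport` (PROVED, RH-FREE).** UNIFORM symbol decay on
every line `Im z = b ≥ 1` for `θ > 10`, with `C = exp(46 θ)`. -/
theorem stub_symbolDecayUniform : ∀ θ : ℝ, 10 < θ → ∃ C : ℝ, ∀ b : ℝ, 1 ≤ b → ∀ u : ℝ,
    ‖thetaSym θ ((u : ℂ) + (b : ℂ) * Complex.I)‖ ≤ C * (1 + |u|) ^ (-(θ / 10)) := by
  intro θ hθ
  have hθ0 : 0 ≤ θ := by linarith
  refine ⟨Real.exp (46 * θ), fun b hb u => ?_⟩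
  have hu1 : 0 < 1 + |u| := by positivity
  rw [norm_thetaSym_line, Real.rpow_def_of_pos hu1, ← Real.exp_add, Real.exp_le_exp]
  set R := (logDeriv riemannXi (((1 / 2 + b : ℝ) : ℂ) + ((-u : ℝ) : ℂ) * I)).re with hR
  have hσ : 3 / 2 ≤ 1 / 2 + b := by linarith
  have hlog1 : 0 ≤ Real.log (1 + |u|) := Real.log_nonneg (by linarith [abs_nonneg u])
  rcases le_or_gt |u| 5 with hu | hu
  · -- |u| ≤ 5: Re ξ'/ξ ≥ 0, and log(1+|u|) ≤ log 6 ≤ 2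
    have hR0 : 0 ≤ R := by
      apply re_logDeriv_riemannXi_nonneg
      simp; linarith
    have hlog6 : Real.log (1 + |u|) ≤ 2 := by
      have he : (6 : ℝ) ≤ Real.exp 2 := by
        have h1 := Real.exp_one_gt_d9
        have h2 : Real.exp 2 = Real.exp 1 * Real.exp 1 := by rw [← Real.exp_add]; norm_num
        nlinarith
      calc Real.log (1 + |u|) ≤ Real.log 6 := Real.log_le_log hu1 (by linarith)
        _ ≤ Real.log (Real.exp 2) := Real.log_le_log (by norm_num) he
        _ = 2 := Real.log_exp 2
    have hp1 : 0 ≤ θ * R := mul_nonneg hθ0 hR0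
    have hp2 : θ * Real.log (1 + |u|) ≤ θ * 2 := mul_le_mul_of_nonneg_left hlog6 hθ0
    linarith
  · -- |u| ≥ 5
    have hdec := re_logDeriv_riemannXi_ge_of_five_le hσ hu.le
    rw [← hR] at hdec
    have hu0 : 0 < |u| := by linarith
    have hlog2 : Real.log (1 + |u|) ≤ Real.log |u| + 1 := by
      have e : 1 + |u| = |u| * (1 + 1 / |u|) := by field_simp; ring
      rw [e, Real.log_mul hu0.ne' (by positivity)]
      have h3 := Real.log_le_sub_one_of_pos (show (0 : ℝ) < 1 + 1 / |u| by positivity)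
      have h15 : 1 / |u| ≤ 1 := by rw [div_le_one hu0]; linarith
      linarith
    have hlog5 : 1 ≤ Real.log |u| := by
      have he : Real.exp 1 ≤ |u| := by have := Real.exp_one_lt_d9; linarith
      calc (1 : ℝ) = Real.log (Real.exp 1) := (Real.log_exp 1).symm
        _ ≤ Real.log |u| := Real.log_le_log (Real.exp_pos 1) he
    have h3 : -2 * θ * R ≤ -2 * θ * (Real.log |u| / 2 - 23) :=
      mul_le_mul_of_nonpos_left hdec (by linarith)
    have h4 : θ / 10 * Real.log (1 + |u|) ≤ θ / 10 * (Real.log |u| + 1) :=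
      mul_le_mul_of_nonneg_left hlog2 (by linarith)
    have hprod : 0 ≤ θ * (9 * Real.log |u| - 1) := mul_nonneg hθ0 (by linarith)
    linarith

end Summit.RiemannHypothesis.RiemannHypothesis.Cruxes.KernelSupport.Birth

end
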